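import Literature.Probability.Divergences.RenyiCountableBridge
import Literature.Probability.Divergences.RenyiProbabilityPreservation
import Mathlib.Probability.ProbabilityMassFunction.Constructions
import HarnessLib

/-!
# Data processing for the Rényi power sum on countable carriers ([vEH14, Thm. 9] / [FGdGJK26] App. A Lemma 15)

Topic `Probability/Divergences`; namespace `Literature.Probability.Divergences`. PROVED, no definition, no named
fact. PRINTED STATEMENT ([FGdGJK26] App. A Lemma 15 «Data Processing Inequality [vEH14, Thm. 9]», HAL hal-05635650v1 p0028
L12–L14; [Pre17] §2.2 Lemma 1 «data processing», held volume chunk p0468): «for any function `f`,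
`R_a(P^f ‖ Q^f) ≤ R_a(P ‖ Q)`», where `P^f` is the law of `f(x)`, `x ∼ P`. Here for laws `P Q : PMF α` on a COUNTABLE carrier,
pushed forward along an arbitrary `f : α → β` into a countable carrier, in the crypto convention's `(a−1)`-th power
(`hellingerIntegral` = `Σ P^a Q^{1−a}` by `RenyiCountableBridge`), for `a > 1` and `Supp(P) ⊆ Supp(Q)`; the finite-carrier twin
is `RenyiFinite.renyiSumFin_map_le`. PROOF = the fibrewise Hölder step (probability preservation on the set `f⁻¹{y}`:
`μ(E)^a ν(E)^{1−a} ≤ ∫_E (dμ/dν)^a dν`, `measure_rpow_mul_rpow_le_setLIntegral`) summed over the countable partition into fibres.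

* `measure_rpow_mul_rpow_le_setLIntegral` — the set form of probability preservation (general measures, `μ ≪ ν`, `a > 1`,
  `ν(E) < ∞`);
* `PMF.map_supp_of_supp` — support inclusion is inherited by push-forwards;
* `hellingerIntegral_map_le` — **data processing**: `hellingerIntegral a (P.map f) (Q.map f) ≤ hellingerIntegral a P Q`;
* `tsum_map_rpow_le_tsum` — the same on the power sums `Σ' y, (P^f y)^a (Q^f y)^{1−a} ≤ Σ' x, (P x)^a (Q x)^{1−a}`.
-/

noncomputable section

open MeasureTheory Set
open scoped ENNReal

namespace Literature.Probability.Divergences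

/-- **Probability preservation, set form**: `μ(E)^a · ν(E)^{1−a} ≤ ∫_E (dμ/dν)^a dν` for `μ ≪ ν`, `a > 1`, `E` measurable with
`ν(E) < ∞`. [cite: FouqueEtAl2026CloserLookFalcon, App. A Lemma 14 (= [LSS14, Lem. 4.1]), proof step (Hölder on `E`)] -/
theorem measure_rpow_mul_rpow_le_setLIntegral {α : Type*} [MeasurableSpace α] {μ ν : Measure α}
    [μ.HaveLebesgueDecomposition ν] (hμν : μ ≪ ν) {a : ℝ} (ha : 1 < a) {E : Set α} (hE : MeasurableSet E)
    (hEtop : ν E ≠ ⊤) :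
    μ E ^ a * ν E ^ (1 - a) ≤ ∫⁻ x in E, (μ.rnDeriv ν x) ^ a ∂ν := by
  have ha0 : 0 < a := by linarith
  by_cases hE0 : ν E = 0
  · -- `ν(E) = 0` forces `μ(E) = 0`; the left side is `0^a · 0^{1−a} = 0 · ⊤ = 0`
    rw [hE0, hμν hE0, ENNReal.zero_rpow_of_pos ha0, zero_mul]
    exact zero_le
  have h1 := measure_le_rpow_setLIntegral_mul_rpow hμν ha hE
  -- raise to the power `a`
  have h2 : μ E ^ a ≤ ((∫⁻ x in E, (μ.rnDeriv ν x) ^ a ∂ν) ^ (1 / a) * (ν E) ^ ((a - 1) / a)) ^ a :=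
    ENNReal.rpow_le_rpow h1 ha0.le
  have h3 : ((∫⁻ x in E, (μ.rnDeriv ν x) ^ a ∂ν) ^ (1 / a) * (ν E) ^ ((a - 1) / a)) ^ a
      = (∫⁻ x in E, (μ.rnDeriv ν x) ^ a ∂ν) * (ν E) ^ (a - 1) := by
    rw [ENNReal.mul_rpow_of_nonneg _ _ ha0.le, ← ENNReal.rpow_mul, ← ENNReal.rpow_mul,
      one_div_mul_cancel ha0.ne', ENNReal.rpow_one, div_mul_cancel₀ _ ha0.ne']
  rw [h3] at h2
  -- multiply by `ν(E)^{1−a}` (finite, nonzero)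
  have h4 : (ν E) ^ (a - 1) * (ν E) ^ (1 - a) = 1 := by
    rw [← ENNReal.rpow_add _ _ hE0 hEtop, show a - 1 + (1 - a) = 0 by ring, ENNReal.rpow_zero]
  calc μ E ^ a * ν E ^ (1 - a)
      ≤ (∫⁻ x in E, (μ.rnDeriv ν x) ^ a ∂ν) * (ν E) ^ (a - 1) * ν E ^ (1 - a) := mul_le_mul' h2 le_rfl
    _ = ∫⁻ x in E, (μ.rnDeriv ν x) ^ a ∂ν := by rw [mul_assoc, h4, mul_one]

variable {α β : Type*} [MeasurableSpace α] [MeasurableSingletonClass α] [Countable α]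
  [MeasurableSpace β] [MeasurableSingletonClass β] [Countable β]

omit [MeasurableSpace α] [MeasurableSingletonClass α] [Countable α] [MeasurableSpace β]
  [MeasurableSingletonClass β] [Countable β] in
/-- Support inclusion passes to push-forwards: `Supp(P) ⊆ Supp(Q) ⇒ Supp(P^f) ⊆ Supp(Q^f)`.
[cite: FouqueEtAl2026CloserLookFalcon, App. A Lemma 15; elementary/ours] -/
theorem PMF.map_supp_of_supp (P Q : PMF α) (hsupp : ∀ x, Q x = 0 → P x = 0) (f : α → β) :
    ∀ y, (Q.map f) y = 0 → (P.map f) y = 0 := by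
  intro y hy
  rw [PMF.apply_eq_zero_iff, PMF.mem_support_map_iff] at hy ⊢
  rintro ⟨x, hx, rfl⟩
  exact hy ⟨x, by
    rw [PMF.mem_support_iff] at hx ⊢
    exact fun h => hx (hsupp x h), rfl⟩

/-- **Data processing inequality on countable carriers**: for `P Q : PMF α` with `Supp(P) ⊆ Supp(Q)`, any `f : α → β`
and `a > 1`, `hellingerIntegral a (P^f) (Q^f) ≤ hellingerIntegral a P Q` (i.e. `R_a(P^f‖Q^f) ≤ R_a(P‖Q)` after the
monotone `1/(a−1)`-th power). [cite: FouqueEtAl2026CloserLookFalcon, App. A Lemma 15 (= [vEH14, Thm. 9]) (p. 27; render p0028 L12–L14); Prest2017RenyiSharperBounds, §2.2 Lemma 1] -/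
theorem hellingerIntegral_map_le (P Q : PMF α) (hsupp : ∀ x, Q x = 0 → P x = 0) (f : α → β) {a : ℝ}
    (ha : 1 < a) :
    hellingerIntegral a (P.map f).toMeasure (Q.map f).toMeasure
      ≤ hellingerIntegral a P.toMeasure Q.toMeasure := by
  have ha0 : 0 < a := by linarith
  have hf : Measurable f := measurable_of_countable f
  have hsupp' := PMF.map_supp_of_supp P Q hsupp f
  have hac : P.toMeasure ≪ Q.toMeasure := PMF.toMeasure_absolutelyContinuous P Q hsupp
  -- left side as a sum over `y` of fibre terms
  rw [hellingerIntegral_toMeasure_eq_tsum _ _ hsupp' ha0]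
  -- right side as the sum over the fibres of the set integrals
  have hfib : ∀ y, MeasurableSet (f ⁻¹' {y}) := fun y => hf (measurableSet_singleton y)
  have hdisj : Pairwise (Function.onFun Disjoint fun y : β => f ⁻¹' {y}) := fun y y' hne =>
    Disjoint.preimage f (disjoint_singleton.mpr hne)
  have hunion : (⋃ y : β, f ⁻¹' {y}) = univ := by
    rw [← preimage_iUnion, iUnion_of_singleton, preimage_univ]
  have hrhs : hellingerIntegral a P.toMeasure Q.toMeasure
      = ∑' y, ∫⁻ x in f ⁻¹' {y}, (P.toMeasure.rnDeriv Q.toMeasure x) ^ a ∂Q.toMeasure := by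
    rw [hellingerIntegral_of_ac hac, ← lintegral_iUnion hfib hdisj, hunion, setLIntegral_univ]
  rw [hrhs]
  refine ENNReal.tsum_le_tsum fun y => ?_
  -- fibre term: `(P^f y)^a (Q^f y)^{1−a} = μ(E)^a ν(E)^{1−a} ≤ ∫_E (dμ/dν)^a dν`
  have hP : (P.map f) y = P.toMeasure (f ⁻¹' {y}) := by
    rw [← PMF.toMeasure_map_apply (f := f) (p := P) (s := {y}) hf (measurableSet_singleton y),
      PMF.toMeasure_apply_singleton _ _ (measurableSet_singleton y)]
  have hQ : (Q.map f) y = Q.toMeasure (f ⁻¹' {y}) := by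
    rw [← PMF.toMeasure_map_apply (f := f) (p := Q) (s := {y}) hf (measurableSet_singleton y),
      PMF.toMeasure_apply_singleton _ _ (measurableSet_singleton y)]
  rw [hP, hQ]
  exact measure_rpow_mul_rpow_le_setLIntegral hac ha (hfib y) (measure_ne_top _ _)

/-- **Data processing, power-sum form**: `Σ' y, (P^f y)^a (Q^f y)^{1−a} ≤ Σ' x, (P x)^a (Q x)^{1−a}` for `a > 1`,
`Supp(P) ⊆ Supp(Q)`, any `f`. [cite: FouqueEtAl2026CloserLookFalcon, App. A Lemma 15 (= [vEH14, Thm. 9]); Prest2017RenyiSharperBounds, §2.2 Lemma 1] -/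
theorem tsum_map_rpow_le_tsum (P Q : PMF α) (hsupp : ∀ x, Q x = 0 → P x = 0) (f : α → β) {a : ℝ}
    (ha : 1 < a) :
    ∑' y, (P.map f) y ^ a * (Q.map f) y ^ (1 - a) ≤ ∑' x, P x ^ a * Q x ^ (1 - a) := by
  have ha0 : 0 < a := by linarith
  rw [← hellingerIntegral_toMeasure_eq_tsum _ _ (PMF.map_supp_of_supp P Q hsupp f) ha0,
    ← hellingerIntegral_toMeasure_eq_tsum _ _ hsupp ha0]
  exact hellingerIntegral_map_le P Q hsupp f ha

end Literature.Probability.Divergences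

end
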